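import Literature.MathematicalPhysics.QuantumFieldTheory.Balaban1983to89.BlockAveragingHaarAC
import Literature.MathematicalPhysics.QuantumFieldTheory.Balaban1983to89.BlockAveragingEMLHaarAC
import Literature.MathematicalPhysics.QuantumFieldTheory.Balaban1983to89.T4TriangularPushforward
import Literature.MathematicalPhysics.QuantumFieldTheory.Balaban1983to89.LatticeWordStokes
import Summits.QuantumFields.YangMills.Theorems.BalabanUVNodesN09CentralWindowAtRecord
import HarnessLib

/-!
# WREG PORT F1a — the iterated central bonds, triangularity of the iterated (0.4) averaging, the one-variable CHAIN map, the iterated central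
# windows, injectivity of the chain on them, and «a UV-small history lies in its own window» (§0 · §0b · §0c of LINE g18-2)

Cell `ym3-torus`, width seat `ym3-torus-px13` g8 (helper of `stmt-QuantumFields-20520` = `UnitScaleTilt.FluctuationComparisonRegPrIntL`, `--supports`,
count-neutral).  PORT of the ideator seat ym-r3-idea-1 g18's map `Cruxes/FluctuationComparisonRegPrIntL/Lines/wreg_chart_port.md` (file F1, split in three
≤ 400-line modules F1a ∕ F1b ∕ F1c sharing ONE namespace `Summit.QuantumFields.YangMills.Theorems.FluctuationComparisonRegPrIntLWregChain`): a VERBATIM move of lines 595–738 of the Cruxes workfile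
`Cruxes/FluctuationComparisonRegPrIntL/Lines/wreg_chart.lean` v20 (sha16 36befdc7ca5b8719) — 34 − 23 = the first 11 declarations `iterCentralBond`, `iterCentralBond_zero`, `iterCentralBond_succ`, `iterCentralBond_injective`, `isLocal_iter_blockAvg`, `chainMap`, `chainMap_zero`, `chainMap_succ`, `centralWindowSet`, `chainWindow`, `chainMap_injOn`, `chainMap_self`, `self_mem_chainWindow` — so that the organ WREG (`WindowRegularity`) becomes citable BY NAME.
Edits relative to the workfile: namespace, import list (the subset this block uses; NOTHING whose closure contains
`Summits.QuantumFields.BalabanUV.T4Continuum.Support.SubstrateBackground` — the port map's HAZARD), section re-opening at the file seams, and NO heartbeat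
budget (the block elaborates at the default and at 100 000).  Statements, docstrings, proofs: unchanged (credit: ideator ym-r3-idea-1 g14–g18; N09 programme).

HONEST FRAMING.  A port proves nothing new.  WREG is ONE organ of S2β `FluctuationPartSmall`; EXW ∕ GAP ∕ LAPLACE ∕ H4ᶜ ∕ LFR♯ᶜ, the polymer line's stubs,
the run-pair package's seven stubs and the crux `FluctuationComparisonRegPrIntL` (stmt-QuantumFields-20520) are NOT proved; rung R3 = YM₃ on T³ for SU(2) —
NOT d = 4, NOT infinite volume, NOT a mass gap, NOT the Clay problem; nothing of Bałaban's is asserted beyond the cited bookkeeping.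
-/

noncomputable section

open MeasureTheory Filter Topology Set
open scoped ENNReal NNReal
open Literature.MathematicalPhysics.QuantumFieldTheory.Balaban1983to89
open Literature.MathematicalPhysics.QuantumFieldTheory.Balaban1983to89.T4Continuum

namespace Summit.QuantumFields.YangMills.Theorems.FluctuationComparisonRegPrIntLWregChain

/-! ## §0 FIRST RUNGS OF CHART-ALG (PROVED): triangularity of the iterated averaging and injectivity of its one-variable chain on the windows. -/

section Triangular

open Function
open Literature.MathematicalPhysics.QuantumFieldTheory.Balaban1983to89.BlockAveraging (Idx avgFun)
open Literature.MathematicalPhysics.QuantumFieldTheory.Balaban1983to89.BlockAveragingHaarAC (centralBond centralBond_injective isLocal_avgFun pre post)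
open Literature.MathematicalPhysics.QuantumFieldTheory.Balaban1983to89.BlockAveragingEMLHaarAC (fibreFamily offCard)
open Literature.MathematicalPhysics.QuantumFieldTheory.Balaban1983to89.ExpMeanLog (expMeanLogSU deltaSU)
open Literature.MathematicalPhysics.QuantumFieldTheory.Balaban1983to89.T4TriangularPushforward (IsLocal)
open Literature.MathematicalPhysics.QuantumFieldTheory.Balaban1983to89.Node00 (SU)
open Summit.QuantumFields.YangMills.BalabanUVNodes.N09CentralWindowAtRecord (avgFun_update_centralBond_injOn_centralWindow)

variable {P : Params}

/-- The ITERATED central bond `βₙ : PBond P n → PBond P 0`, `β₀ = id`, `βₙ₊₁ = βₙ ∘ centralBond` — the private coordinate … -/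
def iterCentralBond : (n : ℕ) → PBond P n → PBond P 0
  | 0 => id
  | n + 1 => iterCentralBond n ∘ centralBond

/-- `β₀ = id` (definitional). [folklore] -/
@[simp] theorem iterCentralBond_zero : (iterCentralBond 0 : PBond P 0 → PBond P 0) = id := rfl

/-- `βₙ₊₁ c = βₙ (centralBond c)` (definitional). [folklore] -/
theorem iterCentralBond_succ (n : ℕ) (c : PBond P (n + 1)) :
    iterCentralBond (n + 1) c = iterCentralBond n (centralBond c) := rfl

/-- `βₙ` is injective in the standing range `n ≤ m + K`. [folklore] -/
theorem iterCentralBond_injective : ∀ {n : ℕ}, n ≤ P.m + P.K → Injective (iterCentralBond n : PBond P n → PBond P 0)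
  | 0, _ => fun _ _ h => h
  | n + 1, hn => fun c c' h =>
      centralBond_injective (by omega) (iterCentralBond_injective (n := n) (by omega) h)

variable {G : Type*} [GaugeGroup G]

/-- ★ **THE `n`-FOLD BLOCK AVERAGING IS TRIANGULAR IN THE ITERATED CENTRAL BONDS**: `Ū⁽ⁿ⁾(c′)` does not depend on `U(βₙ c)` for `c′ ≠ c` … -/
theorem isLocal_iter_blockAvg (ℰ : LoopAverage G) :
    ∀ {n : ℕ}, n ≤ P.m + P.K →
      IsLocal (iterCentralBond n : PBond P n → PBond P 0)
        (Averaging.iter (fun i => BlockAveraging.blockAvg (P := P) (j := i) ℰ) n)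
  | 0, _ => by
      intro U c g c' hc
      simp [Averaging.iter, update_of_ne hc]
  | n + 1, hn => by
      intro U c g c' hc
      have IH := isLocal_iter_blockAvg ℰ (n := n) (by omega)
      set W := Averaging.iter (fun i => BlockAveraging.blockAvg (P := P) (j := i) ℰ) n
        (update U (iterCentralBond (n + 1) c) g) with hW
      set W₀ := Averaging.iter (fun i => BlockAveraging.blockAvg (P := P) (j := i) ℰ) n U with hW₀
      have hWeq : W = update W₀ (centralBond c) (W (centralBond c)) := by
        funext b
        by_cases hb : b = centralBond c
        · subst hb; simp
        · rw [update_of_ne hb]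
          exact IH U (centralBond c) g b hb
      show BlockAveraging.avgFun ℰ W c' = BlockAveraging.avgFun ℰ W₀ c'
      rw [hWeq]
      exact isLocal_avgFun (by omega) ℰ W₀ c (W (centralBond c)) c' hc

/-! ## §0b The one-variable CHAIN of the iterated averaging and its injectivity on iterated central windows -/

/-- The ONE-VARIABLE CHAIN MAP of the `n`-fold averaging at the coarse bond `c` in the environment `U`: `g ↦ Ū⁽ⁿ⁾(c)` at `U[βₙ c ↦ g]`. [folklore] -/
def chainMap (ℰ : LoopAverage G) (n : ℕ) (U : GaugeField P 0 G) (c : PBond P n) (g : G) : G :=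
  Averaging.iter (fun i => BlockAveraging.blockAvg (P := P) (j := i) ℰ) n (update U (iterCentralBond n c) g) c

/-- The depth-`0` chain map is the identity in the pivot variable. [folklore] -/
theorem chainMap_zero (ℰ : LoopAverage G) (U : GaugeField P 0 G) (c : PBond P 0) (g : G) : chainMap ℰ 0 U c g = g := by
  simp [chainMap, Averaging.iter]

/-- ★ **CHAIN RECURSION**: `Ū⁽ⁿ⁺¹⁾(c)` at `U[βₙ₊₁ c ↦ g]` is the ONE-LEVEL one-variable map at the environment `Ū⁽ⁿ⁾(U)` … -/
theorem chainMap_succ (ℰ : LoopAverage G) {n : ℕ} (hn : n + 1 ≤ P.m + P.K) (U : GaugeField P 0 G) (c : PBond P (n + 1)) (g : G) :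
    chainMap ℰ (n + 1) U c g =
      avgFun ℰ (update (Averaging.iter (fun i => BlockAveraging.blockAvg (P := P) (j := i) ℰ) n U) (centralBond c)
        (chainMap ℰ n U (centralBond c) g)) c := by
  have IH := isLocal_iter_blockAvg (P := P) ℰ (n := n) (by omega)
  set W := Averaging.iter (fun i => BlockAveraging.blockAvg (P := P) (j := i) ℰ) n
    (update U (iterCentralBond (n + 1) c) g) with hW
  set W₀ := Averaging.iter (fun i => BlockAveraging.blockAvg (P := P) (j := i) ℰ) n U with hW₀
  have hWeq : W = update W₀ (centralBond c) (W (centralBond c)) := by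
    funext b
    by_cases hb : b = centralBond c
    · subst hb; simp
    · rw [update_of_ne hb]
      exact IH U (centralBond c) g b hb
  have hchain : chainMap ℰ n U (centralBond c) g = W (centralBond c) := rfl
  rw [hchain]
  show BlockAveraging.avgFun ℰ W c = BlockAveraging.avgFun ℰ (update W₀ (centralBond c) (W (centralBond c))) c
  rw [← hWeq]

variable {N : ℕ} [NeZero N]

/-- The central `α`-window of the one-level (0.4) average at environment `W`. [cite: Balaban1987RG1, (0.4) p.253 and (2.9) p.266 (bookkeeping)] -/
def centralWindowSet {j : ℕ} (W : GaugeField P j (SU N)) (c : PBond P (j + 1)) (α : ℝ) : Set (SU N) :=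
  {h : SU N | ∀ i : Idx P, dist1 (fibreFamily W c (pre W c * h * post W c) i) ≤ α}

/-- The ITERATED central window of the chain at `(n, U, c)`: the level-`k` chain values lie in the level-`k` central windows of the intermediate … -/
def chainWindow (α : ℝ) : (n : ℕ) → GaugeField P 0 (SU N) → PBond P n → Set (SU N)
  | 0, _, _ => univ
  | n + 1, U, c => {g | g ∈ chainWindow α n U (centralBond c) ∧
      chainMap (expMeanLogSU (n := Fin N)) n U (centralBond c) g ∈
        centralWindowSet (Averaging.iter (fun i => BlockAveraging.blockAvg (P := P) (j := i) (expMeanLogSU (n := Fin N))) n U) c α}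

/-- ★★ **THE CHAIN IS INJECTIVE ON THE ITERATED CENTRAL WINDOW**. [cite: Balaban1987RG1, (0.4) p.253 and p.267] -/
theorem chainMap_injOn {α : ℝ} (hα0 : 0 ≤ α) (hα : α ≤ 1 / 24) (hαδ : α < deltaSU (Fin N))
    (hgap : ∀ j (c : PBond P (j + 1)), (offCard c : ℝ) / (Fintype.card (Idx P) : ℝ) + 150 * α < 1) :
    ∀ {n : ℕ}, n ≤ P.m + P.K → ∀ (U : GaugeField P 0 (SU N)) (c : PBond P n),
      InjOn (chainMap (expMeanLogSU (n := Fin N)) n U c) (chainWindow α n U c)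
  | 0, _ => fun U c g₁ _ g₂ _ h => by simpa [chainMap_zero] using h
  | n + 1, hn => fun U c g₁ hg₁ g₂ hg₂ h => by
      have h1 := hg₁.2
      have h2 := hg₂.2
      rw [chainMap_succ _ hn, chainMap_succ _ hn] at h
      have hw : chainMap (expMeanLogSU (n := Fin N)) n U (centralBond c) g₁ =
          chainMap (expMeanLogSU (n := Fin N)) n U (centralBond c) g₂ :=
        avgFun_update_centralBond_injOn_centralWindow (by omega) _ c hα0 hα hαδ (hgap n c) h1 h2 h
      exact chainMap_injOn hα0 hα hαδ hgap (n := n) (by omega) U (centralBond c) hg₁.1 hg₂.1 hw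

/-! ### §0c Support bookkeeping: a UV-small history lies in its own iterated central window -/

section SelfWindow

open Literature.MathematicalPhysics.QuantumFieldTheory.Balaban1983to89.BlockAveraging (loopHol)
open Literature.MathematicalPhysics.QuantumFieldTheory.Balaban1983to89.LatticeWordStokes (dist1_loopHol_le)
open Summit.QuantumFields.YangMills.BalabanUVNodes.N09CentralWindowAtRecord (self_mem_centralWindow_iff)

/-- The chain at the configuration's OWN private coordinate is the iterated average itself. [folklore] -/
theorem chainMap_self (ℰ : LoopAverage G) (n : ℕ) (U : GaugeField P 0 G) (c : PBond P n) :
    chainMap ℰ n U c (U (iterCentralBond n c)) = Averaging.iter (fun i => BlockAveraging.blockAvg (P := P) (j := i) ℰ) n U c := by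
  simp [chainMap]

/-- ★ A UV-small history lies in its own iterated central window. [cite: Balaban1987RG1, (0.4) p.253 and (2.9) p.266 (bookkeeping)] -/
theorem self_mem_chainWindow {α : ℝ} (θ : ℕ → ℝ) (hθ0 : ∀ k, 0 ≤ θ k)
    (hθα : ∀ k, ((((P.d + 2) * P.L : ℕ) : ℝ) ^ 2 / 4) * θ k ≤ α) :
    ∀ {n : ℕ}, n ≤ P.m + P.K → ∀ (U : GaugeField P 0 (SU N)) (c : PBond P n),
      (∀ k, k < n → PlaqSmall (θ k) (Averaging.iter (fun i => BlockAveraging.blockAvg (P := P) (j := i) (expMeanLogSU (n := Fin N))) k U)) →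
        U (iterCentralBond n c) ∈ chainWindow α n U c
  | 0, _ => fun U c _ => Set.mem_univ _
  | n + 1, hn => fun U c hsmall => by
      refine ⟨self_mem_chainWindow θ hθ0 hθα (n := n) (by omega) U (centralBond c) fun k hk => hsmall k (by omega), ?_⟩
      show chainMap (expMeanLogSU (n := Fin N)) n U (centralBond c) (U (iterCentralBond n (centralBond c))) ∈ _
      rw [chainMap_self]
      refine (self_mem_centralWindow_iff (by omega) _ c α).2 fun i => ?_
      exact (dist1_loopHol_le (hθ0 n) (hsmall n (by omega)) c i).trans (hθα n)

end SelfWindow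

end Triangular

end Summit.QuantumFields.YangMills.Theorems.FluctuationComparisonRegPrIntLWregChain

end
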